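import Mathlib
import Summits.ValiantsHypothesis.ValiantsHypothesis.Theorems.ProofCarryingSymmetryRestorationQPACCircuitEval

/-!
# Route ProofCarryingSymmetry — crux `RestorationQP`, line `registered`, stub S3″ (`stub_stabilityAtACEquiv`), part 7:
presentation-independent stability at AC budget zero

The stability rung S3 (`stub_stabilityAtACBudget`, part 6) meters invariance by A6–A10-free proofs in
`P_c` between the straight-line PRESENTATIONS `C ∘ σ` and `C`; such proofs are sensitive to the dead
weight that `PICircuit.prefixAt` keeps (a line of the AC fragment of `P_c` one of whose sides has a
leaf as output node is a literal identity).  The robust form of "zero proof length = syntactic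
symmetry" compares the UNFOLDINGS: this file proves

* `acEq_of_pfProof` / `acEq_of_pfProvable` — AC-soundness for `P_f`: an A6–A10-free `P_f` proof of
  `F = G` forces `ACEq F G`; and conversely `pfProvable_of_acEq` — COMPLETENESS of the AC fragment of
  `P_f` for `ACEq` (induction on `ACEq` with the `Provable` calculus of `PIProof.lean`), so that
  "`(C ∘ σ)•` and `C•` are inter-derivable in `P_f` without A6–A10" is exactly `ACEq (C ∘ σ)• C•`,
  independent of the presentation of `C`;
* `topClass_smul_eq_of_pfProvable` — such provability fixes `topClass C`;
* **`stub_stabilityAtACEquiv`** (S3″, registered after the lead's second reshape): if for every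
  `σ ∈ S_n` the formulas `(C ∘ σ)•` and `C•` are inter-derivable in `P_f(ℂ)` without A6–A10, the
  AC-canonical circuit of `C` (parts 5–6) is an `S_n`-symmetric labelled circuit computing `Ĉ` of size
  `≤ (|C| + n + 2)^4`.  S3″ has a weaker hypothesis than S3 (`P_c`-AC-proofs ⇒ `ACEq` of unfoldings ⇒
  `P_f`-AC-proofs), so it implies S3.

Everything proved; no named facts.
-/

-- single-problem summit: `Summit.ValiantsHypothesis.ValiantsHypothesis.…` is the namespace by design (D-0017)
set_option linter.dupNamespace false

noncomputable section

open scoped Classical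

namespace Summit.ValiantsHypothesis.ValiantsHypothesis.Theorems

namespace ACStability

open Literature.Computability.AlgebraicComplexity ACClass

universe u v

variable {𝔽 : Type u} [CommSemiring 𝔽] {X : Type v}

/-! ### AC-soundness for `P_f` -/

/-- An A1–A5 instance on formulas relates AC-equivalent formulas. [folklore] -/
theorem acEq_of_ringAxiom_pf {s : PIAxiom} (hs : ¬ IsNonAC s) {F G : PIFormula 𝔽 X}
    (h : (pfSystem 𝔽 X).RingAxiom s F G) : ACEq F G := by
  cases h with
  | a1 F => exact .refl _
  | a2 F G => exact ACEq.add_comm F G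
  | a3 F G H => exact ACEq.add_assoc F G H
  | a4 F G => exact ACEq.mul_comm F G
  | a5 F G H => exact ACEq.mul_assoc F G H
  | _ => exact absurd (by simp [IsNonAC]) hs

/-- **AC-soundness for `P_f`.** In a `P_f` proof with no instance of A6–A10, every line relates
AC-equivalent formulas. [folklore] -/
theorem acEq_of_pfProof {Γ : List (PIFormula 𝔽 X × PIFormula 𝔽 X)} (π : PFProof 𝔽 X Γ)
    (h : ∀ s, IsNonAC s → π.axiomCount s = 0) :
    ∀ {F G : PIFormula 𝔽 X}, (F, G) ∈ Γ → ACEq F G := by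
  induction π with
  | nil => intro F G hm; simp at hm
  | axm s' hax π ih =>
    intro F G hm
    have hπ : ∀ s, IsNonAC s → π.axiomCount s = 0 := fun s hs => by
      have := h s hs; simp only [PIProof.axiomCount] at this; omega
    have hs' : ¬ IsNonAC s' := fun hs => by
      have := h s' hs; simp [PIProof.axiomCount] at this
    rcases List.mem_cons.1 hm with hm | hm
    · obtain ⟨rfl, rfl⟩ := Prod.mk.injEq _ _ _ _ ▸ hm
      rcases hax with hax | hax
      · exact acEq_of_ringAxiom_pf hs' hax
      · exact hax.elim
    · exact ih hπ hm
  | symm hm' π ih =>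
    intro F G hm
    rcases List.mem_cons.1 hm with hm | hm
    · obtain ⟨rfl, rfl⟩ := Prod.mk.injEq _ _ _ _ ▸ hm
      exact (ih h hm').symm
    · exact ih h hm
  | trans h₁ h₂ π ih =>
    intro F G hm
    rcases List.mem_cons.1 hm with hm | hm
    · obtain ⟨rfl, rfl⟩ := Prod.mk.injEq _ _ _ _ ▸ hm
      exact (ih h h₁).trans (ih h h₂)
    · exact ih h hm
  | addRule h₁ h₂ hF hG π ih =>
    intro F G hm
    rcases List.mem_cons.1 hm with hm | hm
    · obtain ⟨rfl, rfl⟩ := Prod.mk.injEq _ _ _ _ ▸ hm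
      subst hF hG
      exact ACEq.add_congr (ih h h₁) (ih h h₂)
    · exact ih h hm
  | mulRule h₁ h₂ hF hG π ih =>
    intro F G hm
    rcases List.mem_cons.1 hm with hm | hm
    · obtain ⟨rfl, rfl⟩ := Prod.mk.injEq _ _ _ _ ▸ hm
      subst hF hG
      exact ACEq.mul_congr (ih h h₁) (ih h h₂)
    · exact ih h hm

/-- `P_f`-provability within a budget vanishing on A6–A10 forces AC-equivalence. [folklore] -/
theorem acEq_of_pfProvable {F G : PIFormula 𝔽 X} {b : PIAxiom → ℕ∞} (hb : ∀ s, IsNonAC s → b s = 0)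
    (h : (pfSystem 𝔽 X).Provable F G ⊤ b) : ACEq F G := by
  obtain ⟨Γ, π, -, hπ⟩ := h
  refine acEq_of_pfProof π (fun s hs => ?_) List.mem_cons_self
  have := hπ s
  rw [hb s hs, nonpos_iff_eq_zero, Nat.cast_eq_zero] at this
  exact this

/-! ### Completeness of the AC fragment of `P_f` for `ACEq` -/

/-- The line's budget: `0` on A6–A10, unconstrained elsewhere. [folklore] -/
def acb : PIAxiom → ℕ∞ := fun s =>
  if s = PIAxiom.A6 ∨ s = PIAxiom.A7 ∨ s = PIAxiom.A8 ∨ s = PIAxiom.A9 ∨ s = PIAxiom.A10 then 0 else ⊤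

/-- `acb` vanishes exactly on A6–A10. [folklore] -/
theorem acb_eq_zero {s : PIAxiom} (hs : IsNonAC s) : acb s = 0 := if_pos hs

/-- `acb` is additively closed. [folklore] -/
theorem acb_add_acb_le (s : PIAxiom) : acb s + acb s ≤ acb s := by
  unfold acb; split <;> simp

/-- The indicator of a scheme outside A6–A10 is within `acb`. [folklore] -/
theorem indicator_le_acb {s : PIAxiom} (hs : ¬ IsNonAC s) (s' : PIAxiom) :
    (if s = s' then (1 : ℕ∞) else 0) ≤ acb s' := by
  unfold acb
  by_cases h : s = s'
  · subst h; simp [IsNonAC] at hs; simp [hs]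
  · simp [h]

/-- **Completeness of the AC fragment**: AC-equivalent formulas are inter-derivable in `P_f` with no
instance of A6–A10. [folklore] -/
theorem pfProvable_of_acEq {F G : PIFormula 𝔽 X} (h : ACEq F G) : (pfSystem 𝔽 X).Provable F G ⊤ acb := by
  induction h with
  | refl F =>
    exact (PISystem.Provable.refl F).mono le_top (indicator_le_acb (by simp [IsNonAC]))
  | symm _ ih => exact ih.symm.mono le_top fun _ => le_rfl
  | trans _ _ ih₁ ih₂ => exact (ih₁.trans ih₂).mono le_top acb_add_acb_le
  | add_congr _ _ ih₁ ih₂ => exact (ih₁.add ih₂).mono le_top acb_add_acb_le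
  | mul_congr _ _ ih₁ ih₂ => exact (ih₁.mul ih₂).mono le_top acb_add_acb_le
  | add_comm F G =>
    exact (PISystem.Provable.of_isAxiom (.inl (.a2 F G))).mono le_top (indicator_le_acb (by simp [IsNonAC]))
  | add_assoc F G H =>
    exact (PISystem.Provable.of_isAxiom (.inl (.a3 F G H))).mono le_top (indicator_le_acb (by simp [IsNonAC]))
  | mul_comm F G =>
    exact (PISystem.Provable.of_isAxiom (.inl (.a4 F G))).mono le_top (indicator_le_acb (by simp [IsNonAC]))
  | mul_assoc F G H =>
    exact (PISystem.Provable.of_isAxiom (.inl (.a5 F G H))).mono le_top (indicator_le_acb (by simp [IsNonAC]))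

/-- `ACEq` is exactly A6–A10-free inter-derivability in `P_f`. [folklore] -/
theorem acEq_iff_pfProvable {F G : PIFormula 𝔽 X} : ACEq F G ↔ (pfSystem 𝔽 X).Provable F G ⊤ acb :=
  ⟨pfProvable_of_acEq, acEq_of_pfProvable fun _ => acb_eq_zero⟩

/-- An A6–A10-free `P_c` proof of `F = G` yields an A6–A10-free `P_f` proof of `F• = G•` (so the
hypothesis of S3″ is weaker than that of S3). [folklore] -/
theorem pfProvable_unfold_of_hasPCProof {F G : PICircuit 𝔽 X} {b : PIAxiom → ℕ∞}
    (hb : ∀ s, IsNonAC s → b s = 0) (h : HasPCProof F G b) :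
    (pfSystem 𝔽 X).Provable F.unfold G.unfold ⊤ acb :=
  pfProvable_of_acEq (acEq_unfold_of_hasPCProof hb h)

/-- **AC-inter-derivable unfoldings fix the top class.** [folklore] -/
theorem topClass_smul_eq_of_pfProvable {Γ : Type*} [Group Γ] [MulAction Γ X] {γ : Γ}
    {C : PICircuit 𝔽 X} {b : PIAxiom → ℕ∞} (hb : ∀ s, IsNonAC s → b s = 0)
    (h : (pfSystem 𝔽 X).Provable (C.rename fun x => γ • x).unfold C.unfold ⊤ b) :
    γ • topClass C = topClass C := by
  rw [smul_topClass]
  exact mk_eq_mk.2 (acEq_of_pfProvable hb h)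

end ACStability

open Literature.Computability.AlgebraicComplexity in
/-- **Stub S3″ — presentation-independent stability at AC budget zero** (registered stub of the line
`registered` of crux `RestorationQP`, item stmt-ValiantsHypothesis-10343, after the lead's second
reshape): if for every `σ ∈ S_n` the unfoldings `(C ∘ σ)•` and `C•` of a Hrubeš–Tzameret circuit
`C` over `ℂ` in the matrix variables are inter-derivable in `P_f(ℂ)` using only A1–A5 and the rules
(no A6–A10) — equivalently, are equal modulo associativity and commutativity — then the AC-canonical
circuit of `C` is an `S_n`-symmetric labelled arithmetic circuit (Dawar–Wilsenach Def. 3.7)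
computing `Ĉ`, of size `≤ (|C| + n + 2)^4`. [folklore] -/
theorem stub_stabilityAtACEquiv : ∃ c : ℕ, ∀ (n : ℕ) (C : PICircuit ℂ (Fin n × Fin n)), (∀ σ : Equiv.Perm (Fin n), (pfSystem ℂ (Fin n × Fin n)).Provable (C.rename fun x : Fin n × Fin n => σ • x).unfold C.unfold ⊤ (fun s => if s = PIAxiom.A6 ∨ s = PIAxiom.A7 ∨ s = PIAxiom.A8 ∨ s = PIAxiom.A9 ∨ s = PIAxiom.A10 then 0 else ⊤)) → ∃ (G : Type) (_ : Fintype G) (D : LabelledArithCircuit ℂ (Fin n × Fin n) Unit G), D.IsSymmetric (Equiv.Perm (Fin n)) ∧ D.eval (D.output ()) = C.eval ∧ Fintype.card G ≤ (C.size + n + 2) ^ c := by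
  refine ⟨4, fun n C h => ?_⟩
  have hL : ∀ q ∈ ACStability.ACClass.reach (ACStability.topClass C), Multiset.card q.kids < 2 ^ (C.size + 1) :=
    fun _ hq => ACStability.card_kids_lt_of_mem_reach hq
  have ht : ∀ σ : Equiv.Perm (Fin n), σ • ACStability.topClass C = ACStability.topClass C :=
    fun σ => ACStability.topClass_smul_eq_of_pfProvable (fun s hs => if_pos hs) (h σ)
  refine ⟨ACStability.ACGate (ACStability.topClass C) (C.size + 1), inferInstance,
    ACStability.acCircuit (ACStability.topClass C) (C.size + 1) hL,
    ACStability.isSymmetric_acCircuit hL ht, ACStability.eval_output_acCircuit hL, ?_⟩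
  have hcard := ACStability.card_acGate_le (t := ACStability.topClass C) (L := C.size + 1) (C.size + 1)
    (ACStability.card_reach_topClass_le C)
  refine hcard.trans ?_
  set a : ℕ := C.size + 1 with ha
  have h1 : 2 * a + 2 * a * a ^ 2 ≤ (a + 1) ^ 4 := by nlinarith
  calc 2 * a + 2 * a * a ^ 2 ≤ (a + 1) ^ 4 := h1
    _ ≤ (C.size + n + 2) ^ 4 := Nat.pow_le_pow_left (by omega) 4

end Summit.ValiantsHypothesis.ValiantsHypothesis.Theorems

end
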